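import Literature.NumberTheory.GaloisCohomology.Howard2004.PrincipalArtinianQuotMorphismProofs
import Literature.NumberTheory.GaloisCohomology.Howard2004.QuotFunctoriality
import Literature.NumberTheory.GaloisCohomology.Howard2004.TowerMorphism
import Literature.NumberTheory.GaloisRepresentations.GaloisCohomologyScalarAction
import HarnessLib

/-!
# Howard's H.3 over a principal Artinian coefficient ring: reduction of «cartesian on `Quot(T)`» to the
# `π`-power morphisms `T/π^iT → T/π^jT` (theorems only; no definition, no named fact, no `sorry`)

B. Howard, *The Heegner point Kolyvagin system*, Compositio Math. 140 (2004) (arXiv:1202.6340).  Hypothesis H.3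
(p. 7 L65–67): «for every `v ∈ Σ(F)` the local condition `F` at `v` is cartesian on the category `Quot(T)`», typed
VERBATIM as `Howard2004.IsCartesianOnQuotAt ρ R v L` (`SelmerTriples.lean` §E): for EVERY pair of presentations
`T ↠ T/IT`, `T ↠ T/JT` (`IsQuotientBy`) and EVERY injective morphism of `Quot(T)` (`IsQuotMorphism … r f`,
`f ∘ π_I = r · π_J`, Def. 1.1.3) the condition propagated to `T/IT` is the preimage under `H¹(K_v, f)` of the one
propagated to `T/JT`.  For the level rings `A_{m,k} = S_𝔮/π^{mk}` of the Eisenstein specialisation (principal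
Artinian, Rem. 1.1.4) the companion file `PrincipalArtinianQuotMorphismProofs` makes `Quot(T)` explicit (objects
`T/π^iT`, `i ≤ n`; injective morphisms out of a non-zero object = unit multiples of `×π^{j-i}`); this file does the
`H¹` bookkeeping and states the reduction, so that the D1 lineage (`DVRSetting.SatisfiesH.h3` for the Eisenstein
tower) only has to treat the maps `×π^{j-i}` between the `π`-adic quotients — on ONE chain of presentations:

* §1 `H¹` bookkeeping (discrete modules over any field `F`, e.g. `F = K_v`): `cohomologyMap_id_apply`,
  `cohomologyMap_smul_eq_scalarMapH1` (H¹ of `x ↦ c • x` is the tree's scalar action `scalarMapH1`),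
  `comap_scalarMapH1_eq_of_isUnit` (an `R`-stable condition is its own preimage under a unit — Howard's «local
  conditions are `R`-submodules», tree `cond_smul`), `map_scalarMapH1_map_le` (propagated conditions stay `R`-stable),
  `comap_cohomologyMap_eq_of_eq_smul` (`H¹(u·g)⁻¹ L' = H¹(g)⁻¹ L'`), `subsingleton_galoisCohomology_one`.
* §2 transport along isomorphic presentations (`IsQuotientBy.transition`): `transition_transition_apply`,
  `bijective_cohomologyMap_transition`, `propagate_eq_map_transition` (the propagated condition is independent of the
  presentation up to `H¹` of the transition), and
  **`propagate_eq_comap_iff_of_isQuotientBy`**: the cartesian identity for ONE pair of presentations of `T/IT`, `T/JT`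
  (and a morphism read on them) is equivalent to the identity for ANY other pair.
* §3 **`isCartesianOnQuotAt_of_forall_pow`**: `IsCartesianOnQuotAt ρ R v L` follows from the `R`-stability of `L`
  and the cartesian identity `F(T/π^iT) = H¹(g)⁻¹ F(T/π^jT)` for the maps `g` with `g ∘ π_I = π^{j-i} · π_J`,
  `1 ≤ i ≤ j ≤ n`, over arbitrary presentations (reduce to one chain with §2);
  `isCartesianOnQuotAt_of_subsingleton` (places where every `H¹(K_v, ·)` in sight vanishes, e.g. complex places).

Everything is [folklore] functoriality of `H¹` / commutative algebra on top of Howard's Def. 1.1.1–1.1.3, Rem. 1.1.4.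
Cell `pub/bsd-print-x9`, shared μ-item of rows 9/10 (D1 road); seat `bsd-line-x10b-p1-w6`.  No statement about
elliptic curves, Selmer groups or `L`-functions is made; BSD is not proved by any of this.

References: [Howard2004HeegnerKolyvagin] Def. 1.1.1–1.1.3, Rem. 1.1.4, H.3 (arXiv p. 5 L20–44, L88–105; p. 7 L65–67);
[SerreGaloisCohomology1997] I §2.2 (functoriality), I §5.1 (cocycles).
-/

set_option autoImplicit false

noncomputable section

open Function NumberField IsDedekindDomain Field
open scoped NumberField ContRepresentation Classical

namespace Literature.NumberTheory.GaloisCohomology.Howard2004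

open Literature.NumberTheory.GaloisRepresentations
open Literature.NumberTheory.GaloisRepresentations.DiscreteGaloisModule

/-! ## §1 `H¹` bookkeeping -/

section H1

variable {F : Type} [Field F]
  {N : Type} [AddCommGroup N] [TopologicalSpace N] [DiscreteTopology N]
  {N' : Type} [AddCommGroup N'] [TopologicalSpace N'] [DiscreteTopology N']

/-- `H¹` of the identity map is the identity. [cite: SerreGaloisCohomology1997, Ch. I §2.2 (functoriality)] -/
theorem cohomologyMap_id_apply (τ : DiscreteGaloisModule F N) (x : galoisCohomology τ 1) :
    ContinuousRep.cohomologyMap τ τ (AddMonoidHom.id N) continuous_of_discreteTopology (fun _ _ => rfl) 1 x = x := by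
  obtain ⟨z, rfl⟩ := oneCocycleClass_surjective τ.toTopRep x
  refine (cohomologyMap_one_oneCocycleClass _ _ _ _ z).trans ?_
  congr 1

/-- For a trivial module every class of `H¹` vanishes (its cocycle is zero).
[cite: SerreGaloisCohomology1997, Ch. I §5.1 (H¹ by cocycles)] -/
theorem subsingleton_galoisCohomology_one [Subsingleton N] (τ : DiscreteGaloisModule F N) :
    Subsingleton (galoisCohomology τ 1) := by
  refine ⟨fun x y => ?_⟩
  obtain ⟨z, rfl⟩ := oneCocycleClass_surjective τ.toTopRep x
  obtain ⟨w, rfl⟩ := oneCocycleClass_surjective τ.toTopRep y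
  congr 1
  exact Subtype.ext (ContinuousMap.ext fun _ => Subsingleton.elim _ _)

variable {R : Type} [CommRing R] [Module R N] [Module R N']

/-- **`H¹` of the scalar endomorphism `x ↦ c • x` is the scalar action `H¹(c•)`** (tree `galoisCohomology.scalarMapH1`;
both are `[z] ↦ [c • z]`). [cite: SerreGaloisCohomology1997, Ch. I §2.2 (functoriality of Hⁿ in the coefficients)] -/
theorem cohomologyMap_smul_eq_scalarMapH1 (τ : DiscreteGaloisModule F N) (hτ : τ.IsScalarLinear R) (c : R)
    (x : galoisCohomology τ 1) :
    ContinuousRep.cohomologyMap τ τ (DistribSMul.toAddMonoidHom N c) continuous_of_discreteTopology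
        (fun g y => (hτ g c y).symm) 1 x =
      galoisCohomology.scalarMapH1 τ hτ c x := by
  obtain ⟨z, rfl⟩ := oneCocycleClass_surjective τ.toTopRep x
  refine (cohomologyMap_one_oneCocycleClass _ _ _ _ z).trans ?_
  rw [galoisCohomology.scalarMapH1_oneCocycleClass]
  congr 1

/-- An additive subgroup of `H¹` stable under the scalar action (Howard: «local conditions are `R`-submodules»;
tree `cond_smul`) is its own preimage under the action of a UNIT.
[cite: Howard2004HeegnerKolyvagin, Def. 1.1.1 (arXiv p. 5 L20–21)] -/
theorem comap_scalarMapH1_eq_of_isUnit (τ : DiscreteGaloisModule F N) (hτ : τ.IsScalarLinear R)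
    (L : AddSubgroup (galoisCohomology τ 1))
    (hL : ∀ r : R, L.map (galoisCohomology.scalarMapH1 τ hτ r) ≤ L) (u : Rˣ) :
    L.comap (galoisCohomology.scalarMapH1 τ hτ (u : R)) = L := by
  ext x
  constructor
  · intro h
    have hx : galoisCohomology.scalarMapH1 τ hτ ((u⁻¹ : Rˣ) : R)
        (galoisCohomology.scalarMapH1 τ hτ (u : R) x) = x := by
      rw [← AddMonoidHom.comp_apply, ← galoisCohomology.scalarMapH1_mul, Units.inv_mul,
        galoisCohomology.scalarMapH1_one, AddMonoidHom.id_apply]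
    rw [← hx]
    exact hL _ (AddSubgroup.mem_map_of_mem _ h)
  · intro h
    exact hL _ (AddSubgroup.mem_map_of_mem _ h)

/-- **The image of an `R`-stable subgroup under `H¹` of an `R`-linear equivariant map is `R`-stable** (so Howard's
propagated conditions are again `R`-submodules).
[cite: Howard2004HeegnerKolyvagin, Def. 1.1.1 (arXiv p. 5 L20–21 and L36–44: propagated conditions)] -/
theorem map_scalarMapH1_map_le {M₀ : Type} [AddCommGroup M₀] [TopologicalSpace M₀] [DiscreteTopology M₀]
    [Module R M₀] (τ₀ : DiscreteGaloisModule F M₀) (hτ₀ : τ₀.IsScalarLinear R) (τ : DiscreteGaloisModule F N)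
    (hτ : τ.IsScalarLinear R) (φ : M₀ →ₗ[R] N) (hφ : ∀ (g : absoluteGaloisGroup F) (x : M₀), φ (τ₀ g x) = τ g (φ x))
    (L : AddSubgroup (galoisCohomology τ₀ 1))
    (hL : ∀ r : R, L.map (galoisCohomology.scalarMapH1 τ₀ hτ₀ r) ≤ L) (r : R) :
    (L.map (ContinuousRep.cohomologyMap τ₀ τ φ.toAddMonoidHom continuous_of_discreteTopology hφ 1)).map
        (galoisCohomology.scalarMapH1 τ hτ r) ≤
      L.map (ContinuousRep.cohomologyMap τ₀ τ φ.toAddMonoidHom continuous_of_discreteTopology hφ 1) := by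
  intro y hy
  obtain ⟨z, hz, rfl⟩ := AddSubgroup.mem_map.mp hy
  obtain ⟨x, hx, rfl⟩ := AddSubgroup.mem_map.mp hz
  refine AddSubgroup.mem_map.mpr ⟨galoisCohomology.scalarMapH1 τ₀ hτ₀ r x,
    hL r (AddSubgroup.mem_map_of_mem _ hx), ?_⟩
  -- the square `φ ∘ (r•) = (r•) ∘ φ` on `H¹`
  refine ((congrArg _ (cohomologyMap_smul_eq_scalarMapH1 τ₀ hτ₀ r x)).symm.trans ?_)
  refine (cohomologyMap_one_comm_sq τ₀ τ₀ τ τ (DistribSMul.toAddMonoidHom M₀ r)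
    (fun g y => (hτ₀ g r y).symm) φ.toAddMonoidHom hφ φ.toAddMonoidHom hφ (DistribSMul.toAddMonoidHom N r)
    (fun g y => (hτ g r y).symm) (fun x => map_smul φ r x) x).trans ?_
  exact cohomologyMap_smul_eq_scalarMapH1 τ hτ r _

omit [Module R N] in
/-- **Preimage under `H¹` of a unit multiple**: for equivariant additive maps `f = u · g : N → N'` (`u` a unit) and
an `R`-stable `L' ≤ H¹(N')`, `H¹(f)⁻¹(L') = H¹(g)⁻¹(L')`.
[cite: Howard2004HeegnerKolyvagin, Def. 1.1.2–1.1.3 (arXiv p. 5 L88–99)] [cite: SerreGaloisCohomology1997, Ch. I §2.2] -/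
theorem comap_cohomologyMap_eq_of_eq_smul (τ : DiscreteGaloisModule F N) (τ' : DiscreteGaloisModule F N')
    (hτ' : τ'.IsScalarLinear R) (f g : N →+ N')
    (hf : ∀ (σ : absoluteGaloisGroup F) (x : N), f (τ σ x) = τ' σ (f x))
    (hg : ∀ (σ : absoluteGaloisGroup F) (x : N), g (τ σ x) = τ' σ (g x))
    (u : Rˣ) (hfg : ∀ x, f x = (u : R) • g x)
    (L' : AddSubgroup (galoisCohomology τ' 1))
    (hL' : ∀ r : R, L'.map (galoisCohomology.scalarMapH1 τ' hτ' r) ≤ L') :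
    L'.comap (ContinuousRep.cohomologyMap τ τ' f continuous_of_discreteTopology hf 1) =
      L'.comap (ContinuousRep.cohomologyMap τ τ' g continuous_of_discreteTopology hg 1) := by
  ext x
  -- `H¹(f) x = u • H¹(g) x`
  have hsq : galoisCohomology.scalarMapH1 τ' hτ' (u : R)
      (ContinuousRep.cohomologyMap τ τ' g continuous_of_discreteTopology hg 1 x) =
      ContinuousRep.cohomologyMap τ τ' f continuous_of_discreteTopology hf 1 x := by
    refine (cohomologyMap_smul_eq_scalarMapH1 τ' hτ' (u : R) _).symm.trans ?_
    refine (cohomologyMap_one_comm_sq τ τ' τ τ' g hg (DistribSMul.toAddMonoidHom N' (u : R))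
      (fun σ y => (hτ' σ (u : R) y).symm) (AddMonoidHom.id N) (fun _ _ => rfl) f hf
      (fun y => (hfg y).symm) x).trans ?_
    exact congrArg _ (cohomologyMap_id_apply τ x)
  have hcomap := comap_scalarMapH1_eq_of_isUnit τ' hτ' L' hL' u
  constructor
  · intro h
    have h1 : ContinuousRep.cohomologyMap τ τ' g continuous_of_discreteTopology hg 1 x ∈
        L'.comap (galoisCohomology.scalarMapH1 τ' hτ' (u : R)) := by
      change galoisCohomology.scalarMapH1 τ' hτ' (u : R) _ ∈ L'
      rw [hsq]
      exact h
    rw [hcomap] at h1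
    exact h1
  · intro h
    have h1 : ContinuousRep.cohomologyMap τ τ' g continuous_of_discreteTopology hg 1 x ∈
        L'.comap (galoisCohomology.scalarMapH1 τ' hτ' (u : R)) := by
      rw [hcomap]
      exact h
    have h2 : galoisCohomology.scalarMapH1 τ' hτ' (u : R)
        (ContinuousRep.cohomologyMap τ τ' g continuous_of_discreteTopology hg 1 x) ∈ L' := h1
    rw [hsq] at h2
    exact h2

end H1

/-! ## §2 Transport of the cartesian identity along isomorphic presentations -/

section Transport

variable {K : Type} [Field K] [NumberField K] {M : Type} [AddCommGroup M] [TopologicalSpace M]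
  [DiscreteTopology M] {R : Type} [CommRing R] [Module R M]
  {N₁ : Type} [AddCommGroup N₁] [TopologicalSpace N₁] [DiscreteTopology N₁] [Module R N₁]
  {N₂ : Type} [AddCommGroup N₂] [TopologicalSpace N₂] [DiscreteTopology N₂] [Module R N₂]
  {N₁' : Type} [AddCommGroup N₁'] [TopologicalSpace N₁'] [DiscreteTopology N₁'] [Module R N₁']
  {N₂' : Type} [AddCommGroup N₂'] [TopologicalSpace N₂'] [DiscreteTopology N₂'] [Module R N₂']
  {ρ : DiscreteGaloisModule K M} {I J : Ideal R}
  {ρ₁ : DiscreteGaloisModule K N₁} {π₁ : M →ₗ[R] N₁} {ρ₂ : DiscreteGaloisModule K N₂} {π₂ : M →ₗ[R] N₂}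
  {ρ₁' : DiscreteGaloisModule K N₁'} {π₁' : M →ₗ[R] N₁'} {ρ₂' : DiscreteGaloisModule K N₂'} {π₂' : M →ₗ[R] N₂'}

omit [NumberField K] in
/-- The transition map between two presentations OF THE SAME `T/IT` is a left inverse of the opposite one.
[cite: Howard2004HeegnerKolyvagin, Def. 1.1.3 (arXiv p. 5 L93–99: T/IT up to its unique isomorphism)] -/
theorem transition_transition_apply (h₁ : IsQuotientBy ρ I ρ₁ π₁) (h₂ : IsQuotientBy ρ I ρ₂ π₂) (x : N₁) :
    h₂.transition h₁ le_rfl (h₁.transition h₂ le_rfl x) = x := by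
  obtain ⟨m, rfl⟩ := h₁.surjective x
  rw [IsQuotientBy.transition_apply, IsQuotientBy.transition_apply]

/-- `H¹(K_v, ·)` of the transition map between two presentations of the same `T/IT`, at a place `v`.
(An abbreviation-free restatement of `ContinuousRep.cohomologyMap` for the transition; kept as a theorem-level
`have` pattern below.) `H¹` of the transition is bijective, with inverse `H¹` of the opposite transition.
[cite: Howard2004HeegnerKolyvagin, Def. 1.1.3 (arXiv p. 5 L93–99)] [cite: SerreGaloisCohomology1997, Ch. I §2.2] -/
theorem bijective_cohomologyMap_transition (h₁ : IsQuotientBy ρ I ρ₁ π₁) (h₂ : IsQuotientBy ρ I ρ₂ π₂)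
    (v : Place K) :
    Function.Bijective (ContinuousRep.cohomologyMap (ρ₁.toLocal v) (ρ₂.toLocal v)
      (h₁.transition h₂ le_rfl).toAddMonoidHom continuous_of_discreteTopology
      (fun _ x => h₁.transition_equivariant h₂ le_rfl _ x) 1) := by
  have h12 : ∀ x, ContinuousRep.cohomologyMap (ρ₂.toLocal v) (ρ₁.toLocal v)
      (h₂.transition h₁ le_rfl).toAddMonoidHom continuous_of_discreteTopology
      (fun _ x => h₂.transition_equivariant h₁ le_rfl _ x) 1
      (ContinuousRep.cohomologyMap (ρ₁.toLocal v) (ρ₂.toLocal v)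
        (h₁.transition h₂ le_rfl).toAddMonoidHom continuous_of_discreteTopology
        (fun _ x => h₁.transition_equivariant h₂ le_rfl _ x) 1 x) = x := fun x =>
    (cohomologyMap_one_comm_sq (ρ₁.toLocal v) (ρ₂.toLocal v) (ρ₁.toLocal v) (ρ₁.toLocal v)
      (h₁.transition h₂ le_rfl).toAddMonoidHom (fun _ x => h₁.transition_equivariant h₂ le_rfl _ x)
      (h₂.transition h₁ le_rfl).toAddMonoidHom (fun _ x => h₂.transition_equivariant h₁ le_rfl _ x)
      (AddMonoidHom.id N₁) (fun _ _ => rfl) (AddMonoidHom.id N₁) (fun _ _ => rfl)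
      (fun y => transition_transition_apply h₁ h₂ y) x).trans
      ((cohomologyMap_id_apply _ _).trans (cohomologyMap_id_apply _ _))
  have h21 : ∀ y, ContinuousRep.cohomologyMap (ρ₁.toLocal v) (ρ₂.toLocal v)
      (h₁.transition h₂ le_rfl).toAddMonoidHom continuous_of_discreteTopology
      (fun _ x => h₁.transition_equivariant h₂ le_rfl _ x) 1
      (ContinuousRep.cohomologyMap (ρ₂.toLocal v) (ρ₁.toLocal v)
        (h₂.transition h₁ le_rfl).toAddMonoidHom continuous_of_discreteTopology
        (fun _ x => h₂.transition_equivariant h₁ le_rfl _ x) 1 y) = y := fun y =>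
    (cohomologyMap_one_comm_sq (ρ₂.toLocal v) (ρ₁.toLocal v) (ρ₂.toLocal v) (ρ₂.toLocal v)
      (h₂.transition h₁ le_rfl).toAddMonoidHom (fun _ x => h₂.transition_equivariant h₁ le_rfl _ x)
      (h₁.transition h₂ le_rfl).toAddMonoidHom (fun _ x => h₁.transition_equivariant h₂ le_rfl _ x)
      (AddMonoidHom.id N₂) (fun _ _ => rfl) (AddMonoidHom.id N₂) (fun _ _ => rfl)
      (fun y => transition_transition_apply h₂ h₁ y) y).trans
      ((cohomologyMap_id_apply _ _).trans (cohomologyMap_id_apply _ _))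
  exact ⟨Function.LeftInverse.injective h12, Function.RightInverse.surjective h21⟩

/-- **The propagated condition does not depend on the presentation**, up to `H¹` of the transition isomorphism:
`h₂.propagate v L = (h₁.propagate v L).map H¹(e)` for the transition `e : N₁ → N₂`.
[cite: Howard2004HeegnerKolyvagin, Def. 1.1.3 (arXiv p. 5 L93–99)] -/
theorem propagate_eq_map_transition (h₁ : IsQuotientBy ρ I ρ₁ π₁) (h₂ : IsQuotientBy ρ I ρ₂ π₂) (v : Place K)
    (L : AddSubgroup (galoisCohomology (ρ.toLocal v) 1)) :
    h₂.propagate v L = (h₁.propagate v L).map (ContinuousRep.cohomologyMap (ρ₁.toLocal v) (ρ₂.toLocal v)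
      (h₁.transition h₂ le_rfl).toAddMonoidHom continuous_of_discreteTopology
      (fun _ x => h₁.transition_equivariant h₂ le_rfl _ x) 1) := by
  have key : ∀ x : galoisCohomology (ρ.toLocal v) 1,
      ContinuousRep.cohomologyMap (ρ₁.toLocal v) (ρ₂.toLocal v)
        (h₁.transition h₂ le_rfl).toAddMonoidHom continuous_of_discreteTopology
        (fun _ x => h₁.transition_equivariant h₂ le_rfl _ x) 1 (h₁.localCohomologyMap v 1 x) =
      h₂.localCohomologyMap v 1 x := fun x =>
    (cohomologyMap_one_comm_sq (ρ.toLocal v) (ρ₁.toLocal v) (ρ.toLocal v) (ρ₂.toLocal v)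
      π₁.toAddMonoidHom (fun _ m => h₁.equivariant _ m)
      (h₁.transition h₂ le_rfl).toAddMonoidHom (fun _ x => h₁.transition_equivariant h₂ le_rfl _ x)
      (AddMonoidHom.id M) (fun _ _ => rfl) π₂.toAddMonoidHom (fun _ m => h₂.equivariant _ m)
      (fun m => h₁.transition_apply h₂ le_rfl m) x).trans
      (congrArg _ (cohomologyMap_id_apply _ x))
  ext y
  constructor
  · intro hy
    obtain ⟨x, hx, rfl⟩ := AddSubgroup.mem_map.mp hy
    exact AddSubgroup.mem_map.mpr ⟨h₁.localCohomologyMap v 1 x,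
      AddSubgroup.mem_map.mpr ⟨x, hx, rfl⟩, key x⟩
  · intro hy
    obtain ⟨z, hz, rfl⟩ := AddSubgroup.mem_map.mp hy
    obtain ⟨x, hx, rfl⟩ := AddSubgroup.mem_map.mp hz
    exact AddSubgroup.mem_map.mpr ⟨x, hx, (key x).symm⟩

/-- Abstract transport (private helper): for a commuting square `f₂ ∘ e = e' ∘ f₁` of additive maps with `e`
surjective and `e'` injective, `(X.map e').comap f₂ = (X.comap f₁).map e`. [folklore] -/
private theorem comap_map_eq_map_comap_of_comm_sq {A B A' B' : Type*} [AddCommGroup A]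
    [AddCommGroup B] [AddCommGroup A'] [AddCommGroup B'] (e : A →+ B) (e' : A' →+ B') (f₁ : A →+ A')
    (f₂ : B →+ B') (hsq : ∀ a, f₂ (e a) = e' (f₁ a)) (he : Function.Surjective e) (he' : Function.Injective e')
    (X : AddSubgroup A') : (X.map e').comap f₂ = (X.comap f₁).map e := by
  ext b
  obtain ⟨a, rfl⟩ := he b
  constructor
  · intro h
    obtain ⟨x, hx, hxe⟩ := AddSubgroup.mem_map.mp (AddSubgroup.mem_comap.mp h)
    refine AddSubgroup.mem_map.mpr ⟨a, AddSubgroup.mem_comap.mpr ?_, rfl⟩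
    rw [hsq] at hxe
    rwa [← he' hxe]
  · intro h
    obtain ⟨a', ha', hae⟩ := AddSubgroup.mem_map.mp h
    refine AddSubgroup.mem_comap.mpr (AddSubgroup.mem_map.mpr ⟨f₁ a', AddSubgroup.mem_comap.mp ha', ?_⟩)
    rw [← hsq, hae]

/-- **Transport of the cartesian identity along isomorphic presentations**: if `(N₁, π₁)`, `(N₂, π₂)` present
`T/IT`, `(N₁', π₁')`, `(N₂', π₂')` present `T/JT`, and `g₁ : N₁ → N₁'`, `g₂ : N₂ → N₂'` are equivariant additive
maps with `gₖ ∘ πₖ = r · πₖ'` (the SAME morphism of `Quot(T)` read on the two pairs of presentations), then the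
cartesian identity holds for `g₁` iff it holds for `g₂`.
[cite: Howard2004HeegnerKolyvagin, Def. 1.1.2–1.1.3 (arXiv p. 5 L88–99)] -/
theorem propagate_eq_comap_iff_of_isQuotientBy (h₁ : IsQuotientBy ρ I ρ₁ π₁) (h₂ : IsQuotientBy ρ I ρ₂ π₂)
    (h₁' : IsQuotientBy ρ J ρ₁' π₁') (h₂' : IsQuotientBy ρ J ρ₂' π₂') (v : Place K)
    (L : AddSubgroup (galoisCohomology (ρ.toLocal v) 1)) (r : R)
    (g₁ : N₁ →+ N₁') (hg₁ : ∀ (σ : absoluteGaloisGroup K) (x : N₁), g₁ (ρ₁ σ x) = ρ₁' σ (g₁ x))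
    (hg₁c : ∀ m : M, g₁ (π₁ m) = r • π₁' m)
    (g₂ : N₂ →+ N₂') (hg₂ : ∀ (σ : absoluteGaloisGroup K) (x : N₂), g₂ (ρ₂ σ x) = ρ₂' σ (g₂ x))
    (hg₂c : ∀ m : M, g₂ (π₂ m) = r • π₂' m) :
    h₁.propagate v L = (h₁'.propagate v L).comap (ContinuousRep.cohomologyMap (ρ₁.toLocal v) (ρ₁'.toLocal v)
        g₁ continuous_of_discreteTopology (fun _ x => hg₁ _ x) 1) ↔
      h₂.propagate v L = (h₂'.propagate v L).comap (ContinuousRep.cohomologyMap (ρ₂.toLocal v) (ρ₂'.toLocal v)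
        g₂ continuous_of_discreteTopology (fun _ x => hg₂ _ x) 1) := by
  -- the transitions `e : N₁ → N₂`, `e' : N₁' → N₂'` and the square `g₂ ∘ e = e' ∘ g₁`
  have hsq : ∀ x : N₁, g₂ (h₁.transition h₂ le_rfl x) = h₁'.transition h₂' le_rfl (g₁ x) := by
    intro x
    obtain ⟨m, rfl⟩ := h₁.surjective x
    rw [IsQuotientBy.transition_apply, hg₂c, hg₁c, map_smul, IsQuotientBy.transition_apply]
  have hsqH := cohomologyMap_one_comm_sq (ρ₁.toLocal v) (ρ₂.toLocal v) (ρ₁'.toLocal v) (ρ₂'.toLocal v)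
    (h₁.transition h₂ le_rfl).toAddMonoidHom (fun _ x => h₁.transition_equivariant h₂ le_rfl _ x)
    g₂ (fun _ x => hg₂ _ x) g₁ (fun _ x => hg₁ _ x)
    (h₁'.transition h₂' le_rfl).toAddMonoidHom (fun _ x => h₁'.transition_equivariant h₂' le_rfl _ x) hsq
  have hbij := bijective_cohomologyMap_transition h₁ h₂ v
  have hbij' := bijective_cohomologyMap_transition h₁' h₂' v
  have hT := comap_map_eq_map_comap_of_comm_sq _ _ _ _ hsqH hbij.2 hbij'.1 (h₁'.propagate v L)
  -- rewrite both propagated conditions on the second pair through the first pair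
  have e1 := propagate_eq_map_transition h₁ h₂ v L
  have e2 := propagate_eq_map_transition h₁' h₂' v L
  constructor
  · intro h
    exact e1.trans (((congrArg (AddSubgroup.map _) h).trans hT.symm).trans
      (congrArg (AddSubgroup.comap _) e2.symm))
  · intro h
    exact AddSubgroup.map_injective hbij.1
      (e1.symm.trans ((h.trans (congrArg (AddSubgroup.comap _) e2)).trans hT))

end Transport

/-! ## §3 The reduction of H.3 to the `π`-power morphisms -/

section Reduction

variable {K : Type} [Field K] [NumberField K] {M : Type} [AddCommGroup M] [TopologicalSpace M]
  [DiscreteTopology M] {R : Type} [CommRing R] [Module R M]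

/-- At a place where `H¹(K_v, ·)` of every presentation in sight is trivial (e.g. a complex place), every condition
is cartesian on `Quot(T)`. [cite: Howard2004HeegnerKolyvagin, H.3 (arXiv p. 7 L65–67); SelmerTriples reading note (ii): at the complex place the clauses are automatic] -/
theorem isCartesianOnQuotAt_of_subsingleton (ρ : DiscreteGaloisModule K M) (v : Place K)
    (L : AddSubgroup (galoisCohomology (ρ.toLocal v) 1))
    (hv : ∀ (N : Type) [AddCommGroup N] [TopologicalSpace N] [DiscreteTopology N]
      (τ : DiscreteGaloisModule K N), Subsingleton (galoisCohomology (τ.toLocal v) 1)) :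
    IsCartesianOnQuotAt ρ R v L := by
  intro I J N N' _ _ _ _ _ _ _ _ ρI πI ρJ πJ hI hJ r f hf hinj
  haveI := hv N ρI
  exact AddSubgroup.ext fun x => by
    rw [Subsingleton.elim x 0]; exact ⟨fun _ => zero_mem _, fun _ => zero_mem _⟩

variable [IsLocalRing R]

/-- **H.3 REDUCED TO THE `π`-POWER MORPHISMS.**  Let `R` be local with `𝔪 = (π)`, principal Artinian of length `n`,
`T` free over `R` with `R`-linear action (H.0), `v` a place and `L ≤ H¹(K_v, T)` an `R`-stable condition.  If for all
`1 ≤ i ≤ j ≤ n`, all presentations `π_I : T ↠ T/π^iT`, `π_J : T ↠ T/π^jT` and every `R`-linear equivariant `g` with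
`g ∘ π_I = π^{j-i} · π_J` the propagated conditions satisfy `F(T/π^iT) = H¹(g)⁻¹ F(T/π^jT)`, then `F` is cartesian
on `Quot(T)` at `v` in Howard's verbatim sense (all ideals, all presentations, all injective `Quot`-morphisms).
(With `propagate_eq_comap_iff_of_isQuotientBy` the hypothesis may be checked on one chain of presentations.)
[cite: Howard2004HeegnerKolyvagin, H.3 with Def. 1.1.2–1.1.3 and Rem. 1.1.4 (arXiv p. 7 L65–67, p. 5 L88–105)] -/
theorem isCartesianOnQuotAt_of_forall_pow (ρ : DiscreteGaloisModule K M) (hlin : ρ.IsScalarLinear R)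
    [Module.Free R M] {π : R} {n : ℕ} (hmax : IsLocalRing.maximalIdeal R = Ideal.span {π})
    (hP : IsPrincipalArtinianOfLength R n) (v : Place K) (L : AddSubgroup (galoisCohomology (ρ.toLocal v) 1))
    (hL : ∀ r : R, L.map (galoisCohomology.scalarMapH1 (ρ.toLocal v) (hlin.restrictField _) r) ≤ L)
    (hcart : ∀ (i j : ℕ), 1 ≤ i → i ≤ j → j ≤ n →
      ∀ (N N' : Type) [AddCommGroup N] [TopologicalSpace N] [DiscreteTopology N] [Module R N]
        [AddCommGroup N'] [TopologicalSpace N'] [DiscreteTopology N'] [Module R N']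
        (ρI : DiscreteGaloisModule K N) (πI : M →ₗ[R] N) (ρJ : DiscreteGaloisModule K N') (πJ : M →ₗ[R] N')
        (hI : IsQuotientBy ρ (Ideal.span {π ^ i}) ρI πI) (hJ : IsQuotientBy ρ (Ideal.span {π ^ j}) ρJ πJ)
        (g : N →ₗ[R] N')
        (hg : IsQuotMorphism ρ (Ideal.span {π ^ i}) (Ideal.span {π ^ j}) ρI πI ρJ πJ (π ^ (j - i)) g),
        hI.propagate v L = (hJ.propagate v L).comap
          (ContinuousRep.cohomologyMap (ρI.toLocal v) (ρJ.toLocal v) g.toAddMonoidHom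
            continuous_of_discreteTopology (fun _ x => hg.equivariant _ x) 1)) :
    IsCartesianOnQuotAt ρ R v L := by
  intro I J N N' _ _ _ _ _ _ _ _ ρI πI ρJ πJ hI hJ r f hf hinj
  have hn : π ^ n = 0 := pow_eq_zero_of_isPrincipalArtinianOfLength hP hmax
  have hn' : n ≠ 0 → π ^ (n - 1) ≠ 0 := pow_pred_ne_zero_of_isPrincipalArtinianOfLength hP hmax
  obtain ⟨i, hin, rfl⟩ := ideal_eq_span_pow hmax hn I
  obtain ⟨j, hjn, rfl⟩ := ideal_eq_span_pow hmax hn J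
  -- trivial quotient: both sides are subgroups of a trivial `H¹`
  rcases subsingleton_or_nontrivial N with hN | hN
  · haveI := subsingleton_galoisCohomology_one (ρI.toLocal v)
    exact AddSubgroup.ext fun x => by
      rw [Subsingleton.elim x 0]; exact ⟨fun _ => zero_mem _, fun _ => zero_mem _⟩
  -- non-trivial quotient: `T ≠ 0` and `1 ≤ i`
  haveI : Nontrivial M := by
    obtain ⟨x, hx⟩ := exists_ne (0 : N)
    obtain ⟨m, rfl⟩ := hI.surjective x
    exact nontrivial_of_ne m 0 fun h => hx (by rw [h, map_zero])
  have hi : 1 ≤ i := by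
    rcases Nat.eq_zero_or_pos i with h0 | hpos
    · exfalso
      subst h0
      apply not_subsingleton N
      refine ⟨fun x y => ?_⟩
      obtain ⟨a, rfl⟩ := hI.surjective x
      obtain ⟨b, rfl⟩ := hI.surjective y
      have hker : ∀ m : M, πI m = 0 := fun m => by
        rw [← LinearMap.mem_ker, hI.ker_eq, pow_zero, Ideal.span_singleton_one, Submodule.top_smul]
        exact Submodule.mem_top
      rw [hker, hker]
    · exact hpos
  -- the classification: `i ≤ j`, `r = u π^(j-i)`
  obtain ⟨hij, u, rfl⟩ := exists_unit_eq_mul_pow_of_injective hmax hn hn' hi hin hjn hI.ker_eq hJ.ker_eq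
    (f := f.toAddMonoidHom) hf.comp_eq hinj
  -- `g := u⁻¹ • f` is the canonical morphism `×π^(j-i)`
  have hρJ : ρJ.IsScalarLinear R := hJ.isScalarLinear hlin
  have hgc : ∀ m : M, (((u⁻¹ : Rˣ) : R) • f) (πI m) = π ^ (j - i) • πJ m := fun m => by
    rw [LinearMap.smul_apply, hf.comp_eq, ← mul_smul, ← mul_assoc, Units.inv_mul, one_mul]
  have hg : IsQuotMorphism ρ (Ideal.span {π ^ i}) (Ideal.span {π ^ j}) ρI πI ρJ πJ (π ^ (j - i))
      (((u⁻¹ : Rˣ) : R) • f) :=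
    { smul_le := fun x hx => by
        rw [Ideal.mem_span_singleton'] at hx ⊢
        obtain ⟨a, rfl⟩ := hx
        exact ⟨a, by rw [mul_left_comm, ← pow_add, Nat.sub_add_cancel hij]⟩
      comp_eq := hgc
      equivariant := fun σ x => by
        rw [LinearMap.smul_apply, LinearMap.smul_apply, hf.equivariant, hρJ] }
  have hfg : ∀ x, f.toAddMonoidHom x = (u : R) • (((u⁻¹ : Rˣ) : R) • f).toAddMonoidHom x := fun x => by
    change f x = (u : R) • ((((u⁻¹ : Rˣ) : R) • f) x)
    rw [LinearMap.smul_apply, ← mul_smul, Units.mul_inv, one_smul]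
  -- the propagated condition on `T/JT` is `R`-stable
  have hL' : ∀ r' : R, (hJ.propagate v L).map
      (galoisCohomology.scalarMapH1 (ρJ.toLocal v) (hρJ.restrictField _) r') ≤ hJ.propagate v L :=
    fun r' => map_scalarMapH1_map_le (ρ.toLocal v) (hlin.restrictField _) (ρJ.toLocal v) (hρJ.restrictField _)
      πJ (fun _ m => hJ.equivariant _ m) L hL r'
  rw [comap_cohomologyMap_eq_of_eq_smul (ρI.toLocal v) (ρJ.toLocal v) (hρJ.restrictField _) f.toAddMonoidHom
    (((u⁻¹ : Rˣ) : R) • f).toAddMonoidHom (fun _ x => hf.equivariant _ x) (fun _ x => hg.equivariant _ x) u hfg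
    (hJ.propagate v L) hL']
  exact hcart i j hi hij hjn N N' ρI πI ρJ πJ hI hJ _ hg

end Reduction

end Literature.NumberTheory.GaloisCohomology.Howard2004

end
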